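import Literature.AlgebraicTopology.SingularHomology.LoopTransfer
import Literature.AlgebraicTopology.SingularHomology.CircleIntegralCocycle
import Literature.AlgebraicTopology.SingularHomology.CircleProductBetti
import Literature.AlgebraicTopology.SingularHomology.UniversalCoefficientsField
import Literature.AlgebraicTopology.SingularHomology.CohomologyFiniteness
import HarnessLib

/-!
# The Künneth formula for `X × S¹` in cohomology: `Hⁿ⁺¹(X × S¹) ≅ Hⁿ⁺¹(X) ⊕ Hⁿ(X)`

A. Hatcher, *Algebraic Topology* (2002), Thm. 3.15 (Künneth formula `H*(X × Y; R) ≅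
H*(X; R) ⊗ H*(Y; R)` for `Y` with finitely generated free cohomology, via `a × b = p₁*a ⌣ p₂*b`)
in the case `Y = S¹`, `H*(S¹) = R[θ]/θ²`: **`(a, b) ↦ pr₁*a + pr₁*b ⌣ pr₂*θ` is an isomorphism
`Hⁿ⁺¹(X; R) ⊕ Hⁿ(X; R) ≅ Hⁿ⁺¹(X × S¹; R)`**. This file proves:

* `kunnethCircleMap R n` — the map, for every commutative ring `R` and every space `X`, and its
  **injectivity** `kunnethCircleMap_injective` (no finiteness, no field): the slice
  `s : x ↦ (x, 0)` recovers `a` (`s*pr₁* = 𝟙`, `s*pr₂*θ = const*θ = 0`) and then the loop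
  transfer recovers `b` (`∮ (pr₁*b ⌣ pr₂*θ) = ±b`, `LoopTransfer.lean`, `CircleIntegralCocycle.lean`);
  likewise `map_fst_injective` in every degree;
* over a field `F`, for `X` with finite dimensional homology: **surjectivity by counting** — the
  bound `bₙ₊₁(X × S¹) ≤ bₙ₊₁(X) + bₙ(X)` of `CircleProductBetti.lean` and `dim Hᵏ = bₖ`
  (`finrank_singularCohomology_eq_bettiNumber_of_field`) — whence the linear equivalences
  **`kunnethCircle F n : Hⁿ⁺¹(X; F) × Hⁿ(X; F) ≃ₗ[F] Hⁿ⁺¹(X × S¹; F)`** and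
  `kunnethCircleZero F : H⁰(X; F) ≃ₗ[F] H⁰(X × S¹; F)`, the **Betti numbers**
  `bettiNumber_prodCircle_succ : bₙ₊₁(X × S¹) = bₙ₊₁(X) + bₙ(X)`, `bettiNumber_prodCircle_zero`, and
  the corresponding `finrank` statements in cohomology.

(`S¹ = ℝ/ℤ = UnitAddCircle`; spaces `X : Type` since the circle lives in `Type`.) Everything is
proved; no named facts.

## References

* A. Hatcher, *Algebraic Topology*, CUP 2002, §3.2 Thm. 3.15, Example 3.11; §3.B Thm. 3B.6,
  Cor. 3B.7. [HatcherAT2002]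
-/

noncomputable section

open CategoryTheory Limits Set

universe v

namespace Literature.AlgebraicTopology.SingularHomology

variable {X : Type} [TopologicalSpace X]

/-! ### The Künneth map and its injectivity -/

section Ring

variable (R : Type v) [CommRing R]

/-- The slice `s : X → X × S¹`, `x ↦ (x, 0)`. [cite: HatcherAT2002, §3.2 Thm. 3.15] -/
def circleSlice : C(X, X × UnitAddCircle) := (ContinuousMap.id X).prodMk (ContinuousMap.const X 0)

/-- `pr₁ ∘ s = 𝟙`. [folklore] -/
theorem fst_comp_circleSlice : ContinuousMap.fst.comp (circleSlice (X := X)) = ContinuousMap.id X := by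
  ext x; rfl

/-- `pr₂ ∘ s` is constant. [folklore] -/
theorem snd_comp_circleSlice :
    ContinuousMap.snd.comp (circleSlice (X := X)) = ContinuousMap.const X (0 : UnitAddCircle) := by
  ext x; rfl

/-- **The Künneth map** `Hⁿ⁺¹(X; R) × Hⁿ(X; R) → Hⁿ⁺¹(X × S¹; R)`,
`(a, b) ↦ pr₁*a + pr₁*b ⌣ pr₂*θ` (Hatcher 2002, Thm. 3.15 with `H*(S¹) = R ⊕ Rθ`).
[cite: HatcherAT2002, §3.2 Thm. 3.15] -/
def kunnethCircleMap (n : ℕ) :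
    singularCohomology R R X (n + 1) × singularCohomology R R X n →ₗ[R]
      singularCohomology R R (X × UnitAddCircle) (n + 1) :=
  (singularCohomology.map R R ContinuousMap.fst (n + 1)).hom.coprod
    ((cupProduct (rfl : n + 1 = n + 1)).flip
        (singularCohomology.map R R ContinuousMap.snd 1 (circleClass R)) ∘ₗ
      (singularCohomology.map R R ContinuousMap.fst n).hom)

/-- The formula of the Künneth map. [cite: HatcherAT2002, §3.2 Thm. 3.15] -/
@[simp]
theorem kunnethCircleMap_apply (n : ℕ) (a : singularCohomology R R X (n + 1)) (b : singularCohomology R R X n) :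
    kunnethCircleMap R n (a, b) =
      singularCohomology.map R R ContinuousMap.fst (n + 1) a +
        cupProduct (rfl : n + 1 = n + 1) (singularCohomology.map R R ContinuousMap.fst n b)
          (singularCohomology.map R R ContinuousMap.snd 1 (circleClass R)) := rfl

/-- `s*pr₁* = 𝟙`: the slice splits `pr₁*`. [cite: HatcherAT2002, §3.2 Thm. 3.15] -/
theorem map_circleSlice_map_fst (k : ℕ) (a : singularCohomology R R X k) :
    singularCohomology.map R R circleSlice k (singularCohomology.map R R ContinuousMap.fst k a) = a := by
  change (singularCohomology.map R R ContinuousMap.fst k ≫ singularCohomology.map R R circleSlice k) a = a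
  rw [← singularCohomology.map_comp, fst_comp_circleSlice, singularCohomology.map_id]
  rfl

/-- `s*pr₂*θ = 0` (the composite is constant). [cite: HatcherAT2002, §3.2 Thm. 3.15] -/
theorem map_circleSlice_map_snd_circleClass :
    singularCohomology.map R R circleSlice 1 (singularCohomology.map R R ContinuousMap.snd 1 (circleClass R)) =
      (0 : singularCohomology R R X 1) := by
  change (singularCohomology.map R R ContinuousMap.snd 1 ≫ singularCohomology.map R R circleSlice 1) (circleClass R) = 0
  rw [← singularCohomology.map_comp, snd_comp_circleSlice]
  exact map_const_circleClass R (X := X) 0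

/-- The slice recovers the first component: `s*(pr₁*a + pr₁*b ⌣ pr₂*θ) = a`. [cite: HatcherAT2002, §3.2 Thm. 3.15] -/
theorem map_circleSlice_kunnethCircleMap (n : ℕ) (a : singularCohomology R R X (n + 1))
    (b : singularCohomology R R X n) :
    singularCohomology.map R R circleSlice (n + 1) (kunnethCircleMap R n (a, b)) = a := by
  rw [kunnethCircleMap_apply, map_add, map_circleSlice_map_fst, cupProduct_map, map_circleSlice_map_fst,
    map_circleSlice_map_snd_circleClass, map_zero, add_zero]

/-- **`pr₁* : Hᵏ(X) → Hᵏ(X × S¹)` is injective** (split by the slice). [cite: HatcherAT2002, §3.2 Thm. 3.15] -/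
theorem map_fst_injective (k : ℕ) :
    Function.Injective (singularCohomology.map R R (ContinuousMap.fst : C(X × UnitAddCircle, X)) k) :=
  Function.LeftInverse.injective (map_circleSlice_map_fst R k)

/-- **The Künneth map is injective**, for every commutative ring `R` and every space `X`: if
`pr₁*a + pr₁*b ⌣ pr₂*θ = 0` then `a = s*(…) = 0`, and then `b = 0` by the loop transfer
(`cupProduct_map_fst_map_snd_injective` with `⟨θ, loop⟩ = 1`). [cite: HatcherAT2002, §3.2 Thm. 3.15] -/
theorem kunnethCircleMap_injective (n : ℕ) : Function.Injective (kunnethCircleMap R (X := X) n) := by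
  rw [injective_iff_map_eq_zero]
  rintro ⟨a, b⟩ h
  have ha : a = 0 := by
    rw [← map_circleSlice_kunnethCircleMap R n a b, h, map_zero]
  subst ha
  rw [kunnethCircleMap_apply, map_zero, zero_add] at h
  have hu : IsUnit (loopEval (R := R) (M := R) circleLoopSimplex circleLoopSimplex_face (circleClass R)) := by
    rw [circleClass, loopEval_π, iCocycles_circleCocycle, circleCochain_circleLoopSimplex]
    exact isUnit_one
  have hb : b = 0 := by
    refine cupProduct_map_fst_map_snd_injective circleLoopSimplex_face n hu ?_
    dsimp only
    rw [h, map_zero, map_zero, LinearMap.zero_apply]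
  rw [hb, Prod.mk_zero_zero]

end Ring

/-! ### Over a field: bijectivity by counting -/

section Field

variable (F : Type v) [Field F]

/-- `dim_F Hᵏ(Y; F) = dim_F Hₖ(Y; F)` (the tree's `finrank_singularCohomology_eq_bettiNumber_of_field`,
with `bettiNumber` unfolded; a local copy of the helper of `IntersectionFormProofs.lean`, not imported
here to keep the import cone small). [cite: HatcherAT2002, §3.1 Thm. 3.2] -/
private theorem finrank_cohomology_eq_finrank_homology (Y : Type) [TopologicalSpace Y] (k : ℕ) :
    Module.finrank F (singularCohomology F F Y k) = Module.finrank F (singularHomology F F Y k) :=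
  finrank_singularCohomology_eq_bettiNumber_of_field F Y k

/-- **`bₙ₊₁(X × S¹) = bₙ₊₁(X) + bₙ(X)`** and the Künneth map is bijective, for `X` with finite
dimensional homology over the field `F` (the bound `≤` of `CircleProductBetti.lean`, injectivity of
the Künneth map, and `dim Hᵏ = bₖ`). [cite: HatcherAT2002, §3.B Cor. 3B.7] -/
theorem kunnethCircleMap_bijective (h : ∀ k, Module.Finite F (singularHomology F F X k)) (n : ℕ) :
    Function.Bijective (kunnethCircleMap F (X := X) n) ∧
      bettiNumber F (X × UnitAddCircle) (n + 1) = bettiNumber F X (n + 1) + bettiNumber F X n := by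
  haveI := fun k => h k
  haveI hXS : ∀ k, Module.Finite F (singularHomology F F (X × UnitAddCircle) k) :=
    finite_singularHomology_prodCircle F h
  haveI : Module.Finite F (singularCohomology F F X (n + 1)) :=
    finite_singularCohomology_of_finite_singularHomology (n + 1) (fun m _ => h m)
  haveI : Module.Finite F (singularCohomology F F X n) :=
    finite_singularCohomology_of_finite_singularHomology n (fun m _ => h m)
  haveI : Module.Finite F (singularCohomology F F (X × UnitAddCircle) (n + 1)) :=
    finite_singularCohomology_of_finite_singularHomology (n + 1) (fun m _ => hXS m)
  have hinj := kunnethCircleMap_injective F (X := X) n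
  have h1 : Module.finrank F (singularCohomology F F X (n + 1) × singularCohomology F F X n) ≤
      Module.finrank F (singularCohomology F F (X × UnitAddCircle) (n + 1)) :=
    LinearMap.finrank_le_finrank_of_injective hinj
  have h2 : Module.finrank F (singularCohomology F F (X × UnitAddCircle) (n + 1)) ≤
      Module.finrank F (singularCohomology F F X (n + 1)) + Module.finrank F (singularCohomology F F X n) := by
    rw [finrank_cohomology_eq_finrank_homology, finrank_cohomology_eq_finrank_homology,
      finrank_cohomology_eq_finrank_homology]
    exact finrank_singularHomology_prodCircle_succ_le F n
  rw [Module.finrank_prod] at h1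
  have heq : Module.finrank F (singularCohomology F F X (n + 1) × singularCohomology F F X n) =
      Module.finrank F (singularCohomology F F (X × UnitAddCircle) (n + 1)) := by
    rw [Module.finrank_prod]; omega
  refine ⟨⟨hinj, ?_⟩, ?_⟩
  · exact (LinearMap.injective_iff_surjective_of_finrank_eq_finrank heq).1 hinj
  · show Module.finrank F (singularHomology F F (X × UnitAddCircle) (n + 1)) =
      Module.finrank F (singularHomology F F X (n + 1)) + Module.finrank F (singularHomology F F X n)
    rw [← finrank_cohomology_eq_finrank_homology, ← finrank_cohomology_eq_finrank_homology,
      ← finrank_cohomology_eq_finrank_homology]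
    omega

/-- **The Künneth isomorphism `Hⁿ⁺¹(X; F) × Hⁿ(X; F) ≃ₗ[F] Hⁿ⁺¹(X × S¹; F)`**,
`(a, b) ↦ pr₁*a + pr₁*b ⌣ pr₂*θ` (Hatcher 2002, Thm. 3.15 for `Y = S¹`, field coefficients, `X`
with finite dimensional homology). [cite: HatcherAT2002, §3.2 Thm. 3.15] -/
def kunnethCircle (h : ∀ k, Module.Finite F (singularHomology F F X k)) (n : ℕ) :
    (singularCohomology F F X (n + 1) × singularCohomology F F X n) ≃ₗ[F]
      singularCohomology F F (X × UnitAddCircle) (n + 1) :=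
  LinearEquiv.ofBijective (kunnethCircleMap F n) (kunnethCircleMap_bijective F h n).1

/-- The Künneth isomorphism is the Künneth map. [cite: HatcherAT2002, §3.2 Thm. 3.15] -/
@[simp]
theorem kunnethCircle_apply (h : ∀ k, Module.Finite F (singularHomology F F X k)) (n : ℕ)
    (ab : singularCohomology F F X (n + 1) × singularCohomology F F X n) :
    kunnethCircle F h n ab = kunnethCircleMap F n ab := rfl

/-- **`bₙ₊₁(X × S¹; F) = bₙ₊₁(X; F) + bₙ(X; F)`** (Hatcher 2002, Cor. 3B.7). [cite: HatcherAT2002, §3.B Cor. 3B.7] -/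
theorem bettiNumber_prodCircle_succ (h : ∀ k, Module.Finite F (singularHomology F F X k)) (n : ℕ) :
    bettiNumber F (X × UnitAddCircle) (n + 1) = bettiNumber F X (n + 1) + bettiNumber F X n :=
  (kunnethCircleMap_bijective F h n).2

/-- **`b₀(X × S¹; F) = b₀(X; F)`** (`pr₁*` injective and `b₀(X × S¹) ≤ b₀(X)`). [cite: HatcherAT2002, §3.B Cor. 3B.7] -/
theorem bettiNumber_prodCircle_zero (h : ∀ k, Module.Finite F (singularHomology F F X k)) :
    bettiNumber F (X × UnitAddCircle) 0 = bettiNumber F X 0 := by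
  haveI := fun k => h k
  haveI hXS : ∀ k, Module.Finite F (singularHomology F F (X × UnitAddCircle) k) :=
    finite_singularHomology_prodCircle F h
  haveI : Module.Finite F (singularCohomology F F (X × UnitAddCircle) 0) :=
    finite_singularCohomology_of_finite_singularHomology 0 (fun m _ => hXS m)
  haveI : Module.Finite F (singularCohomology F F X 0) :=
    finite_singularCohomology_of_finite_singularHomology 0 (fun m _ => h m)
  refine le_antisymm (finrank_singularHomology_prodCircle_zero_le F) ?_
  show Module.finrank F (singularHomology F F X 0) ≤ Module.finrank F (singularHomology F F (X × UnitAddCircle) 0)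
  rw [← finrank_cohomology_eq_finrank_homology, ← finrank_cohomology_eq_finrank_homology]
  exact LinearMap.finrank_le_finrank_of_injective (map_fst_injective F (X := X) 0)

/-- **`pr₁* : H⁰(X; F) ≃ₗ[F] H⁰(X × S¹; F)`**. [cite: HatcherAT2002, §3.2 Thm. 3.15] -/
def kunnethCircleZero (h : ∀ k, Module.Finite F (singularHomology F F X k)) :
    singularCohomology F F X 0 ≃ₗ[F] singularCohomology F F (X × UnitAddCircle) 0 := by
  haveI := fun k => h k
  haveI hXS : ∀ k, Module.Finite F (singularHomology F F (X × UnitAddCircle) k) :=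
    finite_singularHomology_prodCircle F h
  haveI : Module.Finite F (singularCohomology F F (X × UnitAddCircle) 0) :=
    finite_singularCohomology_of_finite_singularHomology 0 (fun m _ => hXS m)
  haveI : Module.Finite F (singularCohomology F F X 0) :=
    finite_singularCohomology_of_finite_singularHomology 0 (fun m _ => h m)
  refine LinearEquiv.ofBijective (singularCohomology.map F F ContinuousMap.fst 0).hom
    ⟨map_fst_injective F 0, (LinearMap.injective_iff_surjective_of_finrank_eq_finrank ?_).1 (map_fst_injective F 0)⟩
  rw [finrank_cohomology_eq_finrank_homology, finrank_cohomology_eq_finrank_homology]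
  exact (bettiNumber_prodCircle_zero F h).symm

/-- **`dim Hⁿ⁺¹(X × S¹; F) = dim Hⁿ⁺¹(X; F) + dim Hⁿ(X; F)`**. [cite: HatcherAT2002, §3.2 Thm. 3.15] -/
theorem finrank_singularCohomology_prodCircle_succ (h : ∀ k, Module.Finite F (singularHomology F F X k)) (n : ℕ) :
    Module.finrank F (singularCohomology F F (X × UnitAddCircle) (n + 1)) =
      Module.finrank F (singularCohomology F F X (n + 1)) + Module.finrank F (singularCohomology F F X n) := by
  rw [finrank_cohomology_eq_finrank_homology, finrank_cohomology_eq_finrank_homology,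
    finrank_cohomology_eq_finrank_homology]
  exact bettiNumber_prodCircle_succ F h n

end Field

end Literature.AlgebraicTopology.SingularHomology
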